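import Summits.AtomisticToContinuum.FouriersLaw.Theorems.HiddenChargeMazurOddChargeAlgebraToolkitB
import Summits.AtomisticToContinuum.FouriersLaw.Theorems.HiddenChargeMazurOddChargeAlgebraProjections

/-!
# Odd conservation laws of the pinned anharmonic chain — `L₊` raises, `L₋` lowers the weight

Grading lemmas behind the weight peeling (THEOREM R, file `…Peeling`) of the refutation of
`HiddenChargeMazur.OddChargeExists`, for the weight `wt` (`q ↦ 1`, `p ↦ 2`) of the chain algebra
`𝓡 = ℝ[q_x, p_x : x ∈ ℤ]`:

* the top-weight Liouville operator `L₊ = lplus lam β` (`q_x ↦ p_x`, `p_x ↦ F⁺_x` cubic) maps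
  `wt`-homogeneous polynomials of weight `n` to weight `n + 1` (`isWeightedHomogeneous_lplus`),
  the harmonic part `L₋ = lminus ω₂` (`q_x ↦ 0`, `p_x ↦ F⁻_x` linear) maps weight `n` to weight
  `n - 1` (`isWeightedHomogeneous_lminus`);
* on weight components: `component_{n+1} ∘ L₊ = L₊ ∘ component_n`,
  `component_n ∘ L₋ = L₋ ∘ component_{n+1}` (`weightedHomogeneousComponent_lplus/_lminus`);
* momentum reversal `Θ = rev` commutes with the weight components
  (`rev_weightedHomogeneousComponent`).

Everything is checked on monomials via `MvPolynomial.mkDerivation_monomial` and extended by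
linearity. [folklore]
-/

noncomputable section

open MvPolynomial Finsupp
open scoped BigOperators

namespace Summit.AtomisticToContinuum.FouriersLaw.Theorems.OddChargeAlgebra

/-! ## Weighted homogeneity: closure lemmas -/

/-- Weight spaces are closed under negation. [folklore] -/
theorem isWeightedHomogeneous_neg {w : Var → ℕ} {φ : R} {n : ℕ} (h : IsWeightedHomogeneous w φ n) :
    IsWeightedHomogeneous w (-φ) n :=
  (weightedHomogeneousSubmodule ℝ w n).neg_mem h

/-- Weight spaces are closed under subtraction. [folklore] -/
theorem isWeightedHomogeneous_sub {w : Var → ℕ} {φ ψ : R} {n : ℕ} (h₁ : IsWeightedHomogeneous w φ n)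
    (h₂ : IsWeightedHomogeneous w ψ n) : IsWeightedHomogeneous w (φ - ψ) n :=
  (weightedHomogeneousSubmodule ℝ w n).sub_mem h₁ h₂

/-- All weights `wt` are nonzero, so only the constant monomial has weight `0`. [folklore] -/
theorem eq_zero_of_weight_wt_eq_zero {s : Var →₀ ℕ} (h : weight wt s = 0) : s = 0 := by
  ext i
  have hi : wt i ≠ 0 := by cases i <;> simp [wt]
  have := Finsupp.le_weight wt hi s
  simp only [Finsupp.coe_zero, Pi.zero_apply]
  omega

/-- A derivation given by its values `F i` on the variables maps the monomial `X^s` into the weight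
space `N` as soon as every Leibniz term `s_i X^{s - e_i} · F i` lies there. [folklore] -/
theorem isWeightedHomogeneous_mkDerivation_monomial {w : Var → ℕ} {F : Var → R} {s : Var →₀ ℕ}
    {r : ℝ} {N : ℕ}
    (h : ∀ i ∈ s.support,
      IsWeightedHomogeneous w (monomial (s - single i 1) ((s i : ℕ) : ℝ) * F i) N) :
    IsWeightedHomogeneous w (mkDerivation ℝ F (monomial s r)) N := by
  rw [mkDerivation_monomial, Finsupp.sum]
  refine (weightedHomogeneousSubmodule ℝ w N).smul_mem r (Submodule.sum_mem _ fun i hi => ?_)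
  rw [smul_eq_mul]
  exact h i hi

/-! ## `L₊` raises the weight by one, `L₋` lowers it by one -/

/-- The top-weight force `F⁺_x` is `wt`-homogeneous of weight `3`. [folklore] -/
theorem isWeightedHomogeneous_forcePlus (lam β : ℝ) (x : ℤ) :
    IsWeightedHomogeneous wt (forcePlus lam β x) 3 := by
  have hX : ∀ y : ℤ, IsWeightedHomogeneous wt (X (Sum.inl y) : R) 1 := fun y =>
    isWeightedHomogeneous_X ℝ wt (Sum.inl y)
  have h3 : ∀ {φ : R}, IsWeightedHomogeneous wt φ 1 → IsWeightedHomogeneous wt (φ ^ 3) 3 :=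
    fun hφ => by simpa using hφ.pow 3
  unfold forcePlus
  exact (isWeightedHomogeneous_neg ((h3 (hX x)).C_mul lam)).add
    ((isWeightedHomogeneous_sub (h3 (isWeightedHomogeneous_sub (hX _) (hX _)))
      (h3 (isWeightedHomogeneous_sub (hX _) (hX _)))).C_mul β)

/-- The harmonic force `F⁻_x` is `wt`-homogeneous of weight `1`. [folklore] -/
theorem isWeightedHomogeneous_forceMinus (ω₂ : ℝ) (x : ℤ) :
    IsWeightedHomogeneous wt (forceMinus ω₂ x) 1 := by
  have hX : ∀ y : ℤ, IsWeightedHomogeneous wt (X (Sum.inl y) : R) 1 := fun y =>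
    isWeightedHomogeneous_X ℝ wt (Sum.inl y)
  unfold forceMinus
  exact isWeightedHomogeneous_sub ((isWeightedHomogeneous_neg ((hX x).C_mul ω₂)).add
    (isWeightedHomogeneous_sub (hX _) (hX _))) (isWeightedHomogeneous_sub (hX _) (hX _))

/-- `L₊` raises the weight of a monomial by exactly one. [folklore] -/
theorem isWeightedHomogeneous_lplus_monomial (lam β : ℝ) (s : Var →₀ ℕ) (r : ℝ) :
    IsWeightedHomogeneous wt (lplus lam β (monomial s r)) (weight wt s + 1) := by
  unfold lplus
  refine isWeightedHomogeneous_mkDerivation_monomial fun i hi => ?_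
  have hw := Finsupp.weight_sub_single_add (w := wt) (Finsupp.mem_support_iff.mp hi)
  rcases i with x | x
  · have h1 := (isWeightedHomogeneous_monomial wt (s - single (Sum.inl x) 1)
      ((s (Sum.inl x) : ℕ) : ℝ) rfl).mul (isWeightedHomogeneous_X ℝ wt (Sum.inr x))
    have e : weight wt (s - single (Sum.inl x) 1) + wt (Sum.inr x) = weight wt s + 1 := by
      rw [show wt (Sum.inl x) = 1 from rfl] at hw
      rw [show wt (Sum.inr x) = 2 from rfl]
      omega
    rw [e] at h1
    exact h1
  · have h1 := (isWeightedHomogeneous_monomial wt (s - single (Sum.inr x) 1)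
      ((s (Sum.inr x) : ℕ) : ℝ) rfl).mul (isWeightedHomogeneous_forcePlus lam β x)
    have e : weight wt (s - single (Sum.inr x) 1) + 3 = weight wt s + 1 := by
      rw [show wt (Sum.inr x) = 2 from rfl] at hw
      omega
    rw [e] at h1
    exact h1

/-- `L₋` lowers the weight of a monomial by one. [folklore] -/
theorem isWeightedHomogeneous_lminus_monomial (ω₂ : ℝ) (s : Var →₀ ℕ) (r : ℝ) :
    IsWeightedHomogeneous wt (lminus ω₂ (monomial s r)) (weight wt s - 1) := by
  unfold lminus
  refine isWeightedHomogeneous_mkDerivation_monomial fun i hi => ?_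
  have hw := Finsupp.weight_sub_single_add (w := wt) (Finsupp.mem_support_iff.mp hi)
  rcases i with x | x
  · rw [Sum.elim_inl, mul_zero]
    exact isWeightedHomogeneous_zero ℝ wt _
  · have h1 := (isWeightedHomogeneous_monomial wt (s - single (Sum.inr x) 1)
      ((s (Sum.inr x) : ℕ) : ℝ) rfl).mul (isWeightedHomogeneous_forceMinus ω₂ x)
    have e : weight wt (s - single (Sum.inr x) 1) + 1 = weight wt s - 1 := by
      rw [show wt (Sum.inr x) = 2 from rfl] at hw
      omega
    rw [e] at h1
    exact h1

/-- `L₋` kills constants. [folklore] -/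
theorem lminus_monomial_zero (ω₂ : ℝ) (r : ℝ) : lminus ω₂ (monomial (0 : Var →₀ ℕ) r) = 0 := by
  rw [← C_apply, derivation_C]

/-- `L₊` raises the weight by exactly one: it maps `wt`-homogeneous polynomials of weight `n` to
`wt`-homogeneous polynomials of weight `n + 1`. [folklore] -/
theorem isWeightedHomogeneous_lplus : ∀ (lam β : ℝ) (h : R) (n : ℕ), IsWeightedHomogeneous wt h n →
    IsWeightedHomogeneous wt (lplus lam β h) (n + 1) := by
  intro lam β h n hh
  induction hh using IsWeightedHomogeneous.induction_on with
  | zero =>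
    rw [map_zero]
    exact isWeightedHomogeneous_zero ℝ wt _
  | add p q _ _ ihp ihq =>
    rw [map_add]
    exact ihp.add ihq
  | monomial d r hr =>
    rw [← hr]
    exact isWeightedHomogeneous_lplus_monomial lam β d r

/-- `L₋` lowers the weight by one: it maps `wt`-homogeneous polynomials of weight `n` to
`wt`-homogeneous polynomials of weight `n - 1` (constants and weight-one polynomials are killed).
[folklore] -/
theorem isWeightedHomogeneous_lminus (ω₂ : ℝ) {h : R} {n : ℕ} (hh : IsWeightedHomogeneous wt h n) :
    IsWeightedHomogeneous wt (lminus ω₂ h) (n - 1) := by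
  induction hh using IsWeightedHomogeneous.induction_on with
  | zero =>
    rw [map_zero]
    exact isWeightedHomogeneous_zero ℝ wt _
  | add p q _ _ ihp ihq =>
    rw [map_add]
    exact ihp.add ihq
  | monomial d r hr =>
    rw [← hr]
    exact isWeightedHomogeneous_lminus_monomial ω₂ d r

/-- `L₊` raises the weight by exactly one, on components: the weight-`(n+1)` component of `L₊ h`
is `L₊` of the weight-`n` component of `h`. [folklore] -/
theorem weightedHomogeneousComponent_lplus (lam β : ℝ) (n : ℕ) (h : R) :
    weightedHomogeneousComponent wt (n + 1) (lplus lam β h) =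
      lplus lam β (weightedHomogeneousComponent wt n h) := by
  induction h using MvPolynomial.induction_on' with
  | monomial s r =>
    rw [weightedHomogeneousComponent_monomial, weightedHomogeneousComponent_of_mem
      ((mem_weightedHomogeneousSubmodule _ _ _ _).mpr (isWeightedHomogeneous_lplus_monomial lam β s r))]
    by_cases hn : n = weight wt s
    · rw [if_pos (by rw [hn]), if_pos hn]
    · rw [if_neg (by omega), if_neg hn, map_zero]
  | add p q hp hq => rw [map_add, map_add, hp, hq, map_add, map_add]

/-- `L₋` lowers the weight by exactly one, on components: the weight-`n` component of `L₋ h` is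
`L₋` of the weight-`(n+1)` component of `h`. [folklore] -/
theorem weightedHomogeneousComponent_lminus (ω₂ : ℝ) (n : ℕ) (h : R) :
    weightedHomogeneousComponent wt n (lminus ω₂ h) =
      lminus ω₂ (weightedHomogeneousComponent wt (n + 1) h) := by
  induction h using MvPolynomial.induction_on' with
  | monomial s r =>
    rw [weightedHomogeneousComponent_monomial, weightedHomogeneousComponent_of_mem
      ((mem_weightedHomogeneousSubmodule _ _ _ _).mpr (isWeightedHomogeneous_lminus_monomial ω₂ s r))]
    by_cases hn : n + 1 = weight wt s
    · rw [if_pos (by omega), if_pos hn]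
    · rw [if_neg hn, map_zero]
      split_ifs with h0
      · obtain rfl : s = 0 := eq_zero_of_weight_wt_eq_zero (by omega)
        exact lminus_monomial_zero ω₂ r
      · rfl
  | add p q hp hq => rw [map_add, map_add, hp, hq, map_add, map_add]

/-- `L₋` lowers the weight: if every monomial of `g` has weight `≤ W`, the weight-`(W+1)` component
of `L₋ g` vanishes. [folklore] -/
theorem weightedHomogeneousComponent_lminus_eq_zero (ω₂ : ℝ) {g : R} {W : ℕ}
    (hg : ∀ d ∈ g.support, weight wt d ≤ W) :
    weightedHomogeneousComponent wt (W + 1) (lminus ω₂ g) = 0 := by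
  rw [weightedHomogeneousComponent_lminus, weightedHomogeneousComponent_eq_zero', map_zero]
  intro d hd
  have := hg d hd
  omega

/-- The weight-`(W+1)` component of `L g` is `L₊` of the weight-`W` component of `g` when every
monomial of `g` has weight `≤ W` (`L = L₊ + L₋`). [folklore] -/
theorem weightedHomogeneousComponent_liouville_top (ω₂ lam β : ℝ) {g : R} {W : ℕ}
    (hg : ∀ d ∈ g.support, weight wt d ≤ W) :
    weightedHomogeneousComponent wt (W + 1) (liouville ω₂ lam β g) =
      lplus lam β (weightedHomogeneousComponent wt W g) := by
  rw [liouville_eq_lplus_add_lminus, Derivation.add_apply, map_add,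
    weightedHomogeneousComponent_lplus, weightedHomogeneousComponent_lminus_eq_zero ω₂ hg, add_zero]

/-! ## Momentum reversal and the weight components -/

/-- Momentum reversal commutes with the weighted homogeneous components (any weight). [folklore] -/
theorem rev_weightedHomogeneousComponent {w : Var → ℕ} (n : ℕ) (h : R) :
    rev (weightedHomogeneousComponent w n h) = weightedHomogeneousComponent w n (rev h) := by
  induction h using MvPolynomial.induction_on' with
  | monomial m c =>
    rw [weightedHomogeneousComponent_monomial, rev_monomial, weightedHomogeneousComponent_C_mul,
      weightedHomogeneousComponent_monomial]
    split_ifs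
    · exact rev_monomial m c
    · rw [map_zero, mul_zero]
  | add p q hp hq => rw [map_add, map_add, hp, hq, map_add, map_add]

/-- The top weight component of a nonzero polynomial is nonzero: if `m₀ ∈ support g` then the
component of weight `weight wt m₀` of `g` is nonzero. [folklore] -/
theorem weightedHomogeneousComponent_ne_zero_of_mem_support {w : Var → ℕ} {g : R} {m₀ : Var →₀ ℕ}
    (hm₀ : m₀ ∈ g.support) : weightedHomogeneousComponent w (weight w m₀) g ≠ 0 := by
  intro h0
  have := congrArg (coeff m₀) h0
  rw [coeff_weightedHomogeneousComponent, if_pos rfl, coeff_zero] at this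
  exact (MvPolynomial.mem_support_iff.mp hm₀) this

end Summit.AtomisticToContinuum.FouriersLaw.Theorems.OddChargeAlgebra

end
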